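import Literature.Algebra.EuclideanLattices.MRGapCVPIdealised
import Literature.Algebra.EuclideanLattices.MRGapCVPVerifierZ
import HarnessLib

/-!
# The idealised reduction of MR07 Thm. 5.23 with a machine-decidable verifier (tests (b′), (c)) and its correctness — proved

Topic `Algebra/EuclideanLattices` (family `pqc`). Sequel of `MRGapCVPIdealised.lean` (the idealised
reduction `reduction : PMF Bool` of Micciancio–Regev 2007, Thm. 5.23, authors' version pp. 28–31, with
the verifier testing (b) `N⁻¹∑ cos(2π⟨t, wᵢ⟩) < 1/2` and (c) `∑⟨x, wᵢ⟩² ≤ N‖x‖²/(2πd)²`) towards the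
machine-level rendering of `Literature.Computability.Cryptography.MicciancioRegev2007_gapCVP'_to_SIS'`: a
Turing machine cannot evaluate cosines or thresholds involving `π` on its rational data, so — as in the
tree's integer Aharonov–Regev verifier (`ARVerifier.lean`) — the machine will test

  (b′) `θ_b N ≤ ∑ᵢ ‖⟨t, wᵢ⟩‖²_{ℝ/ℤ}`  and  (c) `∑ᵢ ⟨x, wᵢ⟩² ≤ Θ‖x‖²` for all `x`

(the latter through the trace of a power of the integer moment matrix) with rational `θ_b, Θ`. This file
makes the reduction GENERIC in the verifier's acceptance predicate and instantiates it with (b′) ∧ (c):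

* `reductionWith acc` (definition with body) — the reduction of `MRGapCVPIdealised.lean` with an arbitrary
  acceptance predicate `acc` on the blockwise outcomes; `reduction_eq_reductionWith` (the old reduction is
  the instance `acc = accepts`);
* `reductionWith_apply_true_eq_zero` — if no outcome is accepted, the verdict is never NO;
* `toReal_reductionWith_false_le` — **the generic NO-case skeleton**: if for every short independent dual
  set `S` (`‖sⱼ‖ ≤ 8β√n η_ε(L*)`) and admissible denominator the witnesses are rejected with probability
  `≤ E`, then `Pr[verdict = YES] ≤ (T+1)(1−p)^{k₀} + E` (Cor. 5.13 loop, `MRGIVPLoop`);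
* `acceptsZ t θ_b Θ` (definition with body) — every block produced a witness, (b′) and (c);
* `not_acceptsZ_of_infDist_le` — **soundness of (b′) ∧ (c)**: if `dist(t, L) ≤ d` and `Θd² < θ_b N` no
  tuple of dual vectors is accepted (`‖⟨t, w⟩‖_{ℝ/ℤ} ≤ |⟨e, w⟩|` for `t = v + e`, `v ∈ L`, `w ∈ L*`);
* `toReal_indepLaw_cond_rejectZ_le`, `toReal_blocks_not_acceptsZ_le`, `toReal_witnesses_not_acceptsZ_le` —
  the NO-case chain of `MRGapCVPBlocks` / `MRGapCVPIdealised` for the new verifier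
  (`MRGapCVPVerifierZ.measureReal_verifierZ_reject_le`), now for ANY Gaussian parameter `s` at least the
  printed `2√n/(γd)` (a machine uses a rational one): for `θ_b ≤ (1 − 2·2⁻ⁿ)/(2π²) − δ_H` and
  `Θ ≥ 3N(2sβ)²` the witnesses of a NO instance are rejected with probability
  `≤ N(1 − (δ′ − 2mε/(1+ε)))^k + e^{−32Nδ_H²} + e^{−N/(nm)²}(4√n·nm)ⁿ + N·m(1+ε)/(1−ε)2⁻ⁿ`;
* `reductionZ` (definition) and `reductionZ_apply_true_eq_zero`, `toReal_reductionZ_false_le` — the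
  idealised reduction with the new verifier and its two correctness statements.

Admissible constants: the NO case needs `Θ ≥ 12N/(49π²d²) ≈ 0.0248·N/d²` and `θ_b < (1 − 2·2⁻ⁿ)/(2π²) → 0.0507`,
the YES case `Θ d² < θ_b N`; e.g. `Θ = 3N/(100d²)`, `θ_b = 3/80` (the machine's choice, with room for the
`n^{1/k}` slack of the trace test). No named facts.

## References

* D. Micciancio, O. Regev, *Worst-case to average-case reductions based on Gaussian measures*,
  SIAM J. Comput. 37 (2007) 267–302; authors' version, Thm. 5.23 and its proof, pp. 28–31.
* D. Aharonov, O. Regev, *Lattice problems in NP ∩ coNP*, J. ACM 52 (2005) 749–765, §6.1.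
-/

noncomputable section

open Finset Module Submodule Literature.NumberTheory.Sieve.Vinogradov

namespace Literature.Algebra.EuclideanLattices

namespace MicciancioRegev2007

section ReductionWith

open scoped ENNReal Classical Real InnerProductSpace
open MeasureTheory ProbabilityTheory Metric PMF Literature.Probability.Distributions
  Literature.Computability.Cryptography Literature.Computability.Cryptography.SIS

variable {V : Type*} [NormedAddCommGroup V] [InnerProductSpace ℝ V] [FiniteDimensional ℝ V]
  [MeasurableSpace V] [BorelSpace V]
variable (L : Submodule ℤ V) [DiscreteTopology L] [IsZLattice ℝ L]
variable {n : ℕ} [NeZero n] (hn : n = finrank ℝ V)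
variable (q : ℕ) [NeZero q] {m : ℕ} (O : Matrix (Fin n) (Fin m) (ZMod q) → PMF (Fin m → ℤ))

/-! ### The reduction with an arbitrary verifier -/

/-- **The idealised reduction of MR07 Thm. 5.23 with an arbitrary acceptance predicate `acc`** on the
`N` blockwise outcomes (verdict `true` = "NO instance"): the loop of Lemma 5.10 on the dual lattice from
`S₀` for `T + 1` rounds; if it has stopped with an independent set `S`, generate the witnesses with
Gaussian parameter `s = 2√n/(γd)`, `γ = 14π√nβ`, and answer NO iff `acc` holds.
[cite: MicciancioRegev2007, Thm. 5.23 (the reduction, pp. 28–29)] -/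
def reductionWith {N : ℕ} (acc : (Fin N → Option (dualLattice L)) → Prop) (dd β : ℝ)
    (S₀ : Fin n → dualLattice L) (T k₀ k : ℕ) : PMF Bool :=
  ((fun ν : PMF (ℕ × Bool × (Fin n → dualLattice L)) =>
      ν.bind (loopStep (dualLattice L) hn q O β k₀))^[T + 1] (PMF.pure (0, true, S₀))).bind
    fun st =>
      if h : st.2.1 = false ∧ LinearIndependent ℝ (fun j => (st.2.2 j : V)) then
        haveI : NeZero (gridDenom (dualLattice L) hn st.2.2 h.2) :=
          ⟨(gridDenom_spec (dualLattice L) hn st.2.2 h.2).1⟩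
        (witnesses L hn q O st.2.2 h.2 (gridDenom (dualLattice L) hn st.2.2 h.2)
            (2 * Real.sqrt (finrank ℝ V) / (14 * π * Real.sqrt (finrank ℝ V) * β * dd)) β N k).map
          fun o => decide (acc o)
      else PMF.pure false

omit [MeasurableSpace V] [BorelSpace V] in
/-- The reduction of `MRGapCVPIdealised.lean` is `reductionWith` for the verifier `accepts` (tests (b), (c)).
[cite: MicciancioRegev2007, Thm. 5.23 (the reduction, pp. 28–29)] -/
theorem reduction_eq_reductionWith (t : V) (dd β : ℝ) (S₀ : Fin n → dualLattice L) (T k₀ N k : ℕ) :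
    reduction L hn q O t dd β S₀ T k₀ N k = reductionWith L hn q O (accepts L t dd (N := N)) dd β S₀ T k₀ k :=
  rfl

omit [MeasurableSpace V] [BorelSpace V] in
/-- **If no outcome is accepted, the verdict is never NO.** [cite: MicciancioRegev2007, Thm. 5.23 (proof, YES case, p. 29)] -/
theorem reductionWith_apply_true_eq_zero {N : ℕ} {acc : (Fin N → Option (dualLattice L)) → Prop}
    (hacc : ∀ o, ¬ acc o) (dd β : ℝ) (S₀ : Fin n → dualLattice L) (T k₀ k : ℕ) :
    (reductionWith L hn q O acc dd β S₀ T k₀ k) true = 0 := by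
  rw [reductionWith, PMF.bind_apply, ENNReal.tsum_eq_zero]
  intro st
  split_ifs with h
  · rw [PMF.map_apply, ENNReal.tsum_eq_zero.2 fun o => ?_, mul_zero]
    rw [if_neg]
    intro htrue
    exact hacc o ((Bool.decide_iff _).1 htrue.symm)
  · rw [PMF.pure_apply, if_neg (by decide), mul_zero]

/-- **The generic NO-case skeleton of MR07 Thm. 5.23**: with `ε = 2⁻ⁿ`, the modulus condition
`8n√m β ≤ q`, the side condition of Thm. 5.9, a loop length `T` exceeding the potential bound of
Lemma 5.10 from `S₀`, and `p = (δ_{SIS}/(2βm) − 2mε/(1+ε))/3` the per-round success of Cor. 5.13: if for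
every independent dual set `S` with `‖sⱼ‖ ≤ 8β√n η_ε(L*)` and every denominator `d` with `d·L* ⊆ L(S)` the
witnesses are rejected by `acc` with probability at most `E ≥ 0`, then
`Pr[verdict = YES] ≤ (T+1)(1−p)^{k₀} + E`.
[cite: MicciancioRegev2007, Thm. 5.23 (proof, NO case, pp. 29–31) with Cor. 5.13] -/
theorem toReal_reductionWith_false_le (hn2 : 2 ≤ finrank ℝ V) {N : ℕ}
    (acc : (Fin N → Option (dualLattice L)) → Prop) {β dd lam E : ℝ} (hβ : 1 ≤ β) (hm : 0 < m)
    (hq : 8 * n * Real.sqrt m * β ≤ q)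
    (hnum : 1 / (2 * π) + (2⁻¹ : ℝ) ^ finrank ℝ V / (1 - (2⁻¹ : ℝ) ^ finrank ℝ V) +
      ((2⁻¹ : ℝ) ^ finrank ℝ V / (1 - (2⁻¹ : ℝ) ^ finrank ℝ V)) ^ 2 * m ≤ 1 / 6)
    (hlam0 : 0 ≤ lam) (hlam : ∀ v ∈ dualLattice L, v ≠ 0 → lam ≤ ‖v‖)
    (S₀ : Fin n → dualLattice L) (hS₀ : LinearIndependent ℝ fun j => (S₀ j : V)) (T k₀ k : ℕ)
    (hT : (3 / 4 : ℝ) ^ (T + 1) * ∏ j, ‖(S₀ j : V)‖ < lam ^ n)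
    {p₁ : ℝ} (hp₁ : p₁ = (1 / 3 : ℝ) *
        ((((PMF.uniformOfFintype (Matrix (Fin n) (Fin m) (ZMod q))).bind fun A =>
            (O A).map (Prod.mk A)).toOuterMeasure {az | IsSolution az.1 β az.2}).toReal / (2 * β * m) -
          m * (2 * (2⁻¹ : ℝ) ^ finrank ℝ V / (1 + (2⁻¹ : ℝ) ^ finrank ℝ V))))
    (hE0 : 0 ≤ E)
    (hE : ∀ (S : Fin n → dualLattice L) (hS : LinearIndependent ℝ fun j => (S j : V)) (d : ℕ) [NeZero d],
      (∀ x : dualLattice L, d • x ∈ span ℤ (Set.range S)) →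
      (∀ j, ‖(S j : V)‖ ≤ 8 * β * Real.sqrt (finrank ℝ V) *
        smoothingParameter (dualLattice L) ((2⁻¹ : ℝ) ^ finrank ℝ V)) →
      ((witnesses L hn q O S hS d (2 * Real.sqrt (finrank ℝ V) /
          (14 * π * Real.sqrt (finrank ℝ V) * β * dd)) β N k).toOuterMeasure {o | ¬ acc o}).toReal ≤ E) :
    ((reductionWith L hn q O acc dd β S₀ T k₀ k) false).toReal ≤ (T + 1 : ℝ) * (1 - p₁) ^ k₀ + E := by
  set ε : ℝ := (2⁻¹ : ℝ) ^ finrank ℝ V with hεdef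
  have hn1 : 1 ≤ finrank ℝ V := by omega
  have hε0 : 0 < ε := by rw [hεdef]; positivity
  have hε1 : ε < 1 := by
    rw [hεdef]
    calc (2⁻¹ : ℝ) ^ finrank ℝ V ≤ (2⁻¹ : ℝ) ^ 1 := pow_le_pow_of_le_one (by norm_num) (by norm_num) hn1
      _ < 1 := by norm_num
  -- the loop (Cor. 5.13)
  set μT := (fun ν : PMF (ℕ × Bool × (Fin n → dualLattice L)) =>
      ν.bind (loopStep (dualLattice L) hn q O β k₀))^[T + 1] (PMF.pure (0, true, S₀)) with hμT
  set G : Set (ℕ × Bool × (Fin n → dualLattice L)) :=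
    {st | st.2.1 = false ∧ LinearIndependent ℝ (fun j => (st.2.2 j : V)) ∧
      ∀ j, ‖(st.2.2 j : V)‖ ≤ 8 * β * Real.sqrt (finrank ℝ V) * smoothingParameter (dualLattice L) ε}
    with hG
  have hgood := toReal_iterate_loopStep_short_ge (dualLattice L) hn q O hε0 hε1 hβ hm hn1 hq hnum
    hlam0 hlam S₀ hS₀ T k₀ hT hp₁
  rw [← hμT] at hgood
  have hbad : (μT.toOuterMeasure Gᶜ).toReal ≤ (T + 1 : ℝ) * (1 - p₁) ^ k₀ := by
    rw [toReal_toOuterMeasure_compl]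
    change 1 - (T + 1 : ℝ) * (1 - p₁) ^ k₀ ≤ (μT.toOuterMeasure G).toReal at hgood
    linarith
  -- the verdict, state by state
  rw [reductionWith, toReal_bind_apply, ← hμT]
  set f : ℕ × Bool × (Fin n → dualLattice L) → PMF Bool := fun st =>
    if h : st.2.1 = false ∧ LinearIndependent ℝ (fun j => (st.2.2 j : V)) then
      haveI : NeZero (gridDenom (dualLattice L) hn st.2.2 h.2) :=
        ⟨(gridDenom_spec (dualLattice L) hn st.2.2 h.2).1⟩
      (witnesses L hn q O st.2.2 h.2 (gridDenom (dualLattice L) hn st.2.2 h.2)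
          (2 * Real.sqrt (finrank ℝ V) / (14 * π * Real.sqrt (finrank ℝ V) * β * dd)) β N k).map
        fun o => decide (acc o)
    else PMF.pure false with hf
  change ∑' st, (μT st).toReal * ((f st) false).toReal ≤ _
  have hf1 : ∀ st, ((f st) false).toReal ≤ 1 := fun st =>
    ENNReal.toReal_le_of_le_ofReal zero_le_one (by rw [ENNReal.ofReal_one]; exact PMF.coe_le_one _ _)
  have hpt : ∀ st, (μT st).toReal * ((f st) false).toReal ≤
      (μT st).toReal * E + Gᶜ.indicator (fun st => (μT st).toReal) st := by
    intro st
    by_cases hst : st ∈ G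
    · rw [Set.indicator_apply, if_neg (fun h => (Set.mem_compl_iff _ _).mp h hst), add_zero]
      refine mul_le_mul_of_nonneg_left ?_ ENNReal.toReal_nonneg
      obtain ⟨hflag, hS, hshort⟩ := hst
      have hfst : f st = (haveI : NeZero (gridDenom (dualLattice L) hn st.2.2 hS) :=
            ⟨(gridDenom_spec (dualLattice L) hn st.2.2 hS).1⟩
          (witnesses L hn q O st.2.2 hS (gridDenom (dualLattice L) hn st.2.2 hS)
            (2 * Real.sqrt (finrank ℝ V) / (14 * π * Real.sqrt (finrank ℝ V) * β * dd)) β N k).map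
          fun o => decide (acc o)) := by
        rw [hf]
        exact dif_pos ⟨hflag, hS⟩
      rw [hfst]
      haveI : NeZero (gridDenom (dualLattice L) hn st.2.2 hS) :=
        ⟨(gridDenom_spec (dualLattice L) hn st.2.2 hS).1⟩
      rw [← PMF.toOuterMeasure_apply_singleton, PMF.toOuterMeasure_map_apply]
      have hpre : (fun o : Fin N → Option (dualLattice L) => decide (acc o)) ⁻¹' {false} =
          {o | ¬ acc o} := by
        ext o; simp
      rw [hpre]
      exact hE st.2.2 hS (gridDenom (dualLattice L) hn st.2.2 hS)
        (gridDenom_spec (dualLattice L) hn st.2.2 hS).2 hshort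
    · rw [Set.indicator_of_mem (Set.mem_compl hst)]
      nlinarith [ENNReal.toReal_nonneg (a := μT st), hf1 st]
  have hs1 : Summable fun st => (μT st).toReal * ((f st) false).toReal :=
    summable_toReal_mul_of_bounded μT (M := 1) fun st => by
      rw [abs_of_nonneg ENNReal.toReal_nonneg]
      exact hf1 st
  have hs2 : Summable fun st => (μT st).toReal * E + Gᶜ.indicator (fun st => (μT st).toReal) st :=
    ((summable_coe_toReal μT).mul_right E).add ((summable_coe_toReal μT).indicator _)
  refine (hs1.tsum_le_tsum hpt hs2).trans ?_
  rw [((summable_coe_toReal μT).mul_right E).tsum_add ((summable_coe_toReal μT).indicator _),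
    tsum_mul_right, ← toReal_toOuterMeasure_apply,
    ← ENNReal.tsum_toReal_eq (fun st => μT.apply_ne_top st), μT.tsum_coe, ENNReal.toReal_one, one_mul]
  linarith

/-! ### The machine-decidable verifier: tests (b′) and (c) -/

/-- **The verdict of the modified verifier** on `N` blockwise outcomes: every block produced a witness,
(b′) `θ_b N ≤ ∑ᵢ ‖⟨t, wᵢ⟩‖²_{ℝ/ℤ}` (distance to the nearest integer of the phases) and
(c) `∑ᵢ ⟨x, wᵢ⟩² ≤ Θ‖x‖²` for all `x`. [cite: MicciancioRegev2007, Thm. 5.23 (the verifier V, p. 28) — tests in the integer form of AharonovRegev2005 §6.1 / the tree's ARVerifier] -/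
def acceptsZ (t : V) (θb Θ : ℝ) {N : ℕ} (o : Fin N → Option (dualLattice L)) : Prop :=
  (∀ i, o i ≠ none) ∧
    θb * N ≤ ∑ i, distInt ⟪t, (((o i).getD 0 : dualLattice L) : V)⟫_ℝ ^ 2 ∧
    ∀ x : V, ∑ i, ⟪x, (((o i).getD 0 : dualLattice L) : V)⟫_ℝ ^ 2 ≤ Θ * ‖x‖ ^ 2

omit [FiniteDimensional ℝ V] [MeasurableSpace V] [BorelSpace V] [DiscreteTopology L] [IsZLattice ℝ L] in
/-- **The distance-to-`ℤ` statistic is dominated by the offset from any lattice vector**: for dual vectors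
`wᵢ ∈ L*` and `τ ∈ L`, `∑ᵢ ‖⟨t, wᵢ⟩‖²_{ℝ/ℤ} ≤ ∑ᵢ ⟨t − τ, wᵢ⟩²` (`⟨τ, wᵢ⟩ ∈ ℤ` and `‖y‖_{ℝ/ℤ} ≤ |y|`).
[cite: AharonovRegev2005, §6.1 (soundness, p. 11)] -/
theorem sum_distInt_sq_le_sum_inner_sub_sq {ι : Type*} [Fintype ι] {w : ι → V}
    (hw : ∀ i, w i ∈ dualLattice L) {t τ : V} (hτ : τ ∈ L) :
    ∑ i, distInt ⟪t, w i⟫_ℝ ^ 2 ≤ ∑ i, ⟪t - τ, w i⟫_ℝ ^ 2 := by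
  refine Finset.sum_le_sum fun i _ => ?_
  obtain ⟨m, hm⟩ := mem_dualLattice.1 (hw i) τ hτ
  have ht : ⟪t, w i⟫_ℝ = ⟪t - τ, w i⟫_ℝ + m := by
    rw [inner_sub_left, real_inner_comm (w i) τ, ← hm]; ring
  have h1 : distInt ⟪t, w i⟫_ℝ ≤ |⟪t - τ, w i⟫_ℝ| := by
    rw [ht, distInt_add_int]
    exact distInt_le_abs _
  calc distInt ⟪t, w i⟫_ℝ ^ 2 ≤ |⟪t - τ, w i⟫_ℝ| ^ 2 := pow_le_pow_left₀ (distInt_nonneg _) h1 2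
    _ = ⟪t - τ, w i⟫_ℝ ^ 2 := sq_abs _

omit [MeasurableSpace V] [BorelSpace V] [IsZLattice ℝ L] in
/-- **Soundness of (b′) ∧ (c): close targets are never accepted.** If `dist(t, L) ≤ d`, `Θ ≥ 0` and
`Θ d² < θ_b N`, no `N`-tuple of dual vectors passes (b′) and (c): writing `t = τ + e` with `τ ∈ L`,
`‖e‖ ≤ d` (a closest vector), `∑ ‖⟨t, wᵢ⟩‖² ≤ ∑⟨e, wᵢ⟩² ≤ Θ‖e‖² ≤ Θ d² < θ_b N`.
[cite: MicciancioRegev2007, Thm. 5.23 (proof, p. 29: "V outputs No whenever dist(t, L(B)) ≤ d") — AharonovRegev2005 §6.1 soundness for the distance-to-ℤ test] -/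
theorem not_acceptsZ_of_infDist_le {t : V} {dd θb Θ : ℝ} (hdist : infDist t (L : Set V) ≤ dd)
    (hΘ0 : 0 ≤ Θ) {N : ℕ} (hΘ : Θ * dd ^ 2 < θb * N) (o : Fin N → Option (dualLattice L)) :
    ¬ acceptsZ L t θb Θ o := by
  rintro ⟨-, hb, hc⟩
  have hclosed : IsClosed (X := V) L :=
    @AddSubgroup.isClosed_of_discrete _ _ _ _ _ L.toAddSubgroup (inferInstanceAs (DiscreteTopology L))
  obtain ⟨τ, hτ, hτd⟩ := hclosed.exists_infDist_eq_dist ⟨0, L.zero_mem⟩ t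
  have htτ : ‖t - τ‖ ≤ dd := by rw [← dist_eq_norm, ← hτd]; exact hdist
  have h1 := sum_distInt_sq_le_sum_inner_sub_sq L (w := fun i => (((o i).getD 0 : dualLattice L) : V))
    (fun i => ((o i).getD 0).2) (t := t) hτ
  have h2 := hc (t - τ)
  have h3 : Θ * ‖t - τ‖ ^ 2 ≤ Θ * dd ^ 2 :=
    mul_le_mul_of_nonneg_left (pow_le_pow_left₀ (norm_nonneg _) htτ 2) hΘ0
  linarith

/-! ### NO instances: the conditional witness law and the blocks, for the modified verifier -/

/-- **The modified verifier rejects `N` i.i.d. samples of `D` only with small probability** when `D`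
satisfies eq. (16) `∑ D(w) cos(2π⟨t, w⟩) ≤ 2·2⁻ⁿ`, eq. (18) with second-moment bound `ℓ²` and eq. (17)
`Pr_D[‖w‖ ≥ Kℓ] ≤ σ`, for thresholds `θ_b ≤ (1 − 2·2⁻ⁿ)/(2π²) − δ_H` and `Θ ≥ 3Nℓ²`
(`MRGapCVPVerifierZ.measureReal_verifierZ_reject_le` read on the product `PMF`; in print `ℓ = 2sβ`).
[cite: MicciancioRegev2007, Thm. 5.23 (proof, NO case, pp. 30–31) — distance-to-ℤ test] -/
theorem toReal_indepLaw_cond_rejectZ_le (t : V) {ℓ K σ₁ δH θb Θ : ℝ} (hℓ : 0 < ℓ) (hK : 0 < K)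
    {D : PMF (dualLattice L)}
    (h16 : ∑' w, (D w).toReal * Real.cos (2 * π * ⟪t, ((w : dualLattice L) : V)⟫_ℝ) ≤
      2 * (2⁻¹ : ℝ) ^ finrank ℝ V)
    (h18 : ∀ u : V, ‖u‖ = 1 → ∑' w, D w * ENNReal.ofReal (⟪u, ((w : dualLattice L) : V)⟫_ℝ ^ 2) ≤
      ENNReal.ofReal (ℓ ^ 2))
    (h17 : ∑' w, (D w).toReal * (if K * ℓ ≤ ‖((w : dualLattice L) : V)‖ then (1 : ℝ) else 0) ≤ σ₁)
    {C : ℝ≥0∞} (hC : C ≠ ∞) (hnorm : ∑' w, D w * (‖((w : dualLattice L) : V)‖ₑ : ℝ≥0∞) ^ 2 ≤ C)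
    (N : ℕ) [NeZero N] (hδH : 0 ≤ δH)
    (hθb : θb ≤ (1 - 2 * (2⁻¹ : ℝ) ^ finrank ℝ V) / (2 * π ^ 2) - δH) (hΘ : N * (3 * ℓ ^ 2) ≤ Θ) :
    ((indepLaw N fun _ => D).toOuterMeasure
        {ω | ¬ (θb * N ≤ ∑ i, distInt ⟪t, ((ω i : dualLattice L) : V)⟫_ℝ ^ 2 ∧
          ∀ x : V, ∑ i, ⟪x, ((ω i : dualLattice L) : V)⟫_ℝ ^ 2 ≤ Θ * ‖x‖ ^ 2)}).toReal ≤
      Real.exp (-(32 * N * δH ^ 2)) +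
        (Real.exp (-(N / K ^ 4)) * (4 * Real.sqrt (finrank ℝ V) * K ^ 2) ^ finrank ℝ V + N * σ₁) := by
  set P := (indepLaw N fun _ => D).toMeasure with hP
  set w : Fin N → (Fin N → dualLattice L) → V := fun i ω => ((ω i : dualLattice L) : V) with hw
  have hlaw : ∀ i, HasLaw (fun ω : Fin N → dualLattice L => ω i) D.toMeasure P := fun i =>
    hasLaw_eval_indepLaw N (fun _ => D) i
  have hind : iIndepFun w P :=
    (iIndepFun_eval_indepLaw N fun _ => D).comp (fun _ (x : dualLattice L) => (x : V))
      fun _ => measurable_of_countable _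
  have hlint : ∀ (i : Fin N) (F : dualLattice L → ℝ≥0∞),
      ∫⁻ ω, F (ω i) ∂P = ∑' x, D x * F x := fun i F => by
    rw [← lintegral_toMeasure_eq_tsum, ← (hlaw i).map_eq,
      lintegral_map (measurable_of_countable F) (measurable_pi_apply i)]
  have hL2 : ∀ i, MemLp (w i) 2 P := fun i =>
    memLp_two_toMeasure_of_lintegral_sq_le _ (measurable_of_countable _).aestronglyMeasurable hC
      (by rw [hlint i (fun x => (‖((x : dualLattice L) : V)‖ₑ : ℝ≥0∞) ^ 2)]; exact hnorm)
  have h16' : ∀ i, ∫ ω, Real.cos (2 * π * ⟪t, w i ω⟫_ℝ) ∂P ≤ 2 * (2⁻¹ : ℝ) ^ finrank ℝ V := by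
    intro i
    have h := (hlaw i).integral_comp
      (f := fun x : dualLattice L => Real.cos (2 * π * ⟪t, ((x : dualLattice L) : V)⟫_ℝ))
      (measurable_of_countable _).aestronglyMeasurable
    have hI : ∫ ω, Real.cos (2 * π * ⟪t, w i ω⟫_ℝ) ∂P =
        ∫ x, Real.cos (2 * π * ⟪t, ((x : dualLattice L) : V)⟫_ℝ) ∂D.toMeasure := h
    rw [hI, integral_toMeasure_eq_tsum_of_abs_le D (M := 1) fun x => Real.abs_cos_le_one _]
    exact h16
  have h18' : ∀ i (u : V), ‖u‖ = 1 → ∫ ω, ⟪u, w i ω⟫_ℝ ^ 2 ∂P ≤ ℓ ^ 2 := by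
    intro i u hu
    rw [integral_eq_lintegral_of_nonneg_ae (ae_of_all _ fun _ => sq_nonneg _)
      (measurable_of_countable _).aestronglyMeasurable]
    refine ENNReal.toReal_le_of_le_ofReal (sq_nonneg _) ?_
    rw [hlint i (fun x => ENNReal.ofReal (⟪u, ((x : dualLattice L) : V)⟫_ℝ ^ 2))]
    exact h18 u hu
  have h17' : ∀ i, P.real {ω | K * ℓ ≤ ‖w i ω‖} ≤ σ₁ := by
    intro i
    set T : Set (dualLattice L) := {x | K * ℓ ≤ ‖((x : dualLattice L) : V)‖} with hT
    have hpre : {ω : Fin N → dualLattice L | K * ℓ ≤ ‖w i ω‖} = (fun ω => ω i) ⁻¹' T := rfl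
    rw [measureReal_def, hpre, ← Measure.map_apply (measurable_pi_apply i) T.to_countable.measurableSet,
      (hlaw i).map_eq, PMF.toMeasure_apply_eq_toOuterMeasure_apply,
      toReal_toOuterMeasure_apply]
    · refine le_of_eq_of_le (tsum_congr fun x => ?_) h17
      simp only [hT, Set.indicator_apply, Set.mem_setOf_eq]
      split_ifs <;> simp
    · exact T.to_countable.measurableSet
  have hΘ' : Fintype.card (Fin N) * (3 * ℓ ^ 2) ≤ Θ := by rwa [Fintype.card_fin]
  have h := measureReal_verifierZ_reject_le hind hL2 t h16' hδH hθb hℓ hK h18' h17' hΘ'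
  simp only [Fintype.card_fin] at h
  rwa [hP, measureReal_indepLaw_eq_toReal] at h

/-- **`N` blocks of `k` runs of `W` yield a tuple accepted by the modified verifier except with probability
`≤ N·Pr[abort]^k + e^{−32Nδ_H²} + e^{−N/K⁴}(4√nK²)ⁿ + Nσ`**, whenever the conditional witness law `D`
(`Pr[W = w] = Pr[¬abort]·D(w)`) satisfies eqs. (16)–(18) (second-moment bound `ℓ²`, tail at `Kℓ`),
`θ_b ≤ (1 − 2·2⁻ⁿ)/(2π²) − δ_H` and `Θ ≥ 3Nℓ²`.
[cite: MicciancioRegev2007, Thm. 5.23 (proof, NO case, pp. 29–31) — distance-to-ℤ test] -/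
theorem toReal_blocks_not_acceptsZ_le (t : V) {ℓ K σ₁ δH θb Θ : ℝ} (hℓ : 0 < ℓ) (hK : 0 < K)
    (p : PMF (Option (dualLattice L))) {D : PMF (dualLattice L)}
    (hD : ∀ w, p (some w) = (1 - p none) * D w)
    (h16 : ∑' w, (D w).toReal * Real.cos (2 * π * ⟪t, ((w : dualLattice L) : V)⟫_ℝ) ≤
      2 * (2⁻¹ : ℝ) ^ finrank ℝ V)
    (h18 : ∀ u : V, ‖u‖ = 1 → ∑' w, D w * ENNReal.ofReal (⟪u, ((w : dualLattice L) : V)⟫_ℝ ^ 2) ≤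
      ENNReal.ofReal (ℓ ^ 2))
    (h17 : ∑' w, (D w).toReal * (if K * ℓ ≤ ‖((w : dualLattice L) : V)‖ then (1 : ℝ) else 0) ≤ σ₁)
    {C : ℝ≥0∞} (hC : C ≠ ∞) (hnorm : ∑' w, D w * (‖((w : dualLattice L) : V)‖ₑ : ℝ≥0∞) ^ 2 ≤ C)
    (N k : ℕ) [NeZero N] (hδH : 0 ≤ δH)
    (hθb : θb ≤ (1 - 2 * (2⁻¹ : ℝ) ^ finrank ℝ V) / (2 * π ^ 2) - δH) (hΘ : N * (3 * ℓ ^ 2) ≤ Θ) :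
    ((indepLaw N fun _ => (indepLaw k fun _ => p).map fun v => (List.ofFn v).findSome? id).toOuterMeasure
        {o | ¬ acceptsZ L t θb Θ o}).toReal ≤
      N * (p none ^ k).toReal +
        (Real.exp (-(32 * N * δH ^ 2)) +
          (Real.exp (-(N / K ^ 4)) * (4 * Real.sqrt (finrank ℝ V) * K ^ 2) ^ finrank ℝ V + N * σ₁)) := by
  refine (toReal_indepLaw_firstSuccess_le p hD N k {o | ¬ acceptsZ L t θb Θ o}).trans ?_
  gcongr
  have hset : {w : Fin N → dualLattice L | (fun j => some (w j)) ∈ {o : Fin N → Option (dualLattice L) |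
      ¬ acceptsZ L t θb Θ o}} =
      {ω | ¬ (θb * N ≤ ∑ i, distInt ⟪t, ((ω i : dualLattice L) : V)⟫_ℝ ^ 2 ∧
        ∀ x : V, ∑ i, ⟪x, ((ω i : dualLattice L) : V)⟫_ℝ ^ 2 ≤ Θ * ‖x‖ ^ 2)} := by
    ext w
    simp only [acceptsZ, Set.mem_setOf_eq, ne_eq, reduceCtorEq, not_false_eq_true, implies_true,
      true_and, Option.getD_some]
  rw [hset]
  exact toReal_indepLaw_cond_rejectZ_le L t hℓ hK h16 h18 h17 hC hnorm N hδH hθb hΘ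

omit [NeZero n] in
/-- **The witnesses of a NO instance are rejected by the modified verifier only with small probability**,
for any short independent dual set `S` (`‖sⱼ‖ ≤ 8β√n η_ε(L*)`, `ε = 2⁻ⁿ`), denominator `d` with
`d·L* ⊆ L(S)`, and ANY Gaussian parameter `s` at least the printed one, `s ≥ 2√n/(γd)` (`γ = 14π√nβ`;
a machine uses a rational `s`): with `δ′` the oracle's `SIS′` success on uniform queries, `K = √(nm)`,
thresholds `θ_b ≤ (1 − 2ε)/(2π²) − δ_H`, `Θ ≥ 3N(2sβ)²`:
`Pr[¬accept] ≤ N(1 − (δ′ − 2mε/(1+ε)))^k + e^{−32Nδ_H²} + e^{−N/K⁴}(4√nK²)ⁿ + N·m(1+ε)/(1−ε)ε`.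
Ingredients: (15) `η_ε(L*) < √n/(γd) ≤ s/2`; Lemma 5.8 (iii) `‖x − Cz‖ ≤ 2βη < sβ`; the abort bound of
`W`; eqs. (16)–(18) for the conditional witness law (for (16) with `g = 2√n/s ≤ γd < λ₁(L)`,
`g < dist(kt, L)` for odd `k`); Hoeffding and Lemma 5.20.
[cite: MicciancioRegev2007, Thm. 5.23 (proof, NO case, pp. 29–31) — distance-to-ℤ test] -/
theorem toReal_witnesses_not_acceptsZ_le (S : Fin n → dualLattice L)
    (hS : LinearIndependent ℝ fun j => (S j : V)) (d : ℕ) [NeZero d]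
    (hd : ∀ x : dualLattice L, d • x ∈ span ℤ (Set.range S)) (hn2 : 2 ≤ finrank ℝ V) (t : V)
    {β dd δH θb Θ : ℝ} (s : ℝ) (hβ : 1 ≤ β) (hdd : 0 < dd) (hm : 0 < m)
    (hgL : 14 * π * Real.sqrt (finrank ℝ V) * β * dd < minNorm L)
    (hodd : ∀ k : ℤ, Odd k → 14 * π * Real.sqrt (finrank ℝ V) * β * dd < infDist ((k : ℝ) • t) (L : Set V))
    (hsle : 2 * Real.sqrt (finrank ℝ V) / (14 * π * Real.sqrt (finrank ℝ V) * β * dd) ≤ s)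
    (hshort : ∀ j, ‖(S j : V)‖ ≤ 8 * β * Real.sqrt (finrank ℝ V) *
      smoothingParameter (dualLattice L) ((2⁻¹ : ℝ) ^ finrank ℝ V))
    (hmod : 4 * Real.sqrt m * ((n : ℝ) * Real.sqrt n) * β ≤ q)
    (hnum : 1 / (2 * π) + (2⁻¹ : ℝ) ^ finrank ℝ V / (1 - (2⁻¹ : ℝ) ^ finrank ℝ V) +
      ((2⁻¹ : ℝ) ^ finrank ℝ V / (1 - (2⁻¹ : ℝ) ^ finrank ℝ V)) ^ 2 * m ≤ 1)
    (hδ : m * (2 * (2⁻¹ : ℝ) ^ finrank ℝ V / (1 + (2⁻¹ : ℝ) ^ finrank ℝ V)) <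
      (((PMF.uniformOfFintype (Matrix (Fin n) (Fin m) (ZMod q))).bind fun A =>
          (O A).map (Prod.mk A)).toOuterMeasure {az | IsSolution' az.1 β az.2}).toReal)
    (N k : ℕ) [NeZero N] (hδH : 0 ≤ δH)
    (hθb : θb ≤ (1 - 2 * (2⁻¹ : ℝ) ^ finrank ℝ V) / (2 * π ^ 2) - δH)
    (hΘ : N * (3 * (2 * s * β) ^ 2) ≤ Θ) :
    ((witnesses L hn q O S hS d s β N k).toOuterMeasure {o | ¬ acceptsZ L t θb Θ o}).toReal ≤
      N * (1 - ((((PMF.uniformOfFintype (Matrix (Fin n) (Fin m) (ZMod q))).bind fun A =>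
          (O A).map (Prod.mk A)).toOuterMeasure {az | IsSolution' az.1 β az.2}).toReal -
            m * (2 * (2⁻¹ : ℝ) ^ finrank ℝ V / (1 + (2⁻¹ : ℝ) ^ finrank ℝ V)))) ^ k +
        (Real.exp (-(32 * N * δH ^ 2)) +
          (Real.exp (-(N / Real.sqrt (finrank ℝ V * m) ^ 4)) *
              (4 * Real.sqrt (finrank ℝ V) * Real.sqrt (finrank ℝ V * m) ^ 2) ^ finrank ℝ V +
            N * (m * ((1 + (2⁻¹ : ℝ) ^ finrank ℝ V) / (1 - (2⁻¹ : ℝ) ^ finrank ℝ V) *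
              (2⁻¹ : ℝ) ^ finrank ℝ V)))) := by
  -- notation
  set ε : ℝ := (2⁻¹ : ℝ) ^ finrank ℝ V with hεdef
  set g : ℝ := 14 * π * Real.sqrt (finrank ℝ V) * β * dd with hgdef
  set b' := gridBasis (dualLattice L) S hS hn (q * d) with hb'
  set rep' := Function.surjInv (gridClass_surjective (gridBasis (dualLattice L) S hS hn (q * d)) (q * d)
    (dualLattice L)) with hrep'
  have hSL : ∀ j, ((q * d : ℕ) : ℝ) • b' j ∈ dualLattice L := smul_gridBasis_mem (dualLattice L) S hS hn (q * d)
  have hrep : ∀ a, gridClass b' (q * d) (dualLattice L) (rep' a) = a := Function.surjInv_eq _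
  have hLL' : dualLattice L ≤ span ℤ (Set.range b') := le_span_gridBasis (dualLattice L) S hS hn q d hd
  set p : PMF (Option (dualLattice L)) := wRun b' q d (dualLattice L) rep' hSL hrep O s β with hpdef
  have hpS : wRunS L hn q O S hS d s β = p := rfl
  -- basic positivity
  have hn1 : 1 ≤ finrank ℝ V := by omega
  have hnpos : 0 < finrank ℝ V := by omega
  have hβ0 : 0 < β := by linarith
  have hε0 : 0 < ε := by rw [hεdef]; positivity
  have hε1 : ε < 1 := by
    rw [hεdef]
    calc (2⁻¹ : ℝ) ^ finrank ℝ V ≤ (2⁻¹ : ℝ) ^ 1 := pow_le_pow_of_le_one (by norm_num) (by norm_num) hn1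
      _ < 1 := by norm_num
  have hsq : 0 < Real.sqrt (finrank ℝ V) := Real.sqrt_pos.2 (by exact_mod_cast hnpos)
  have hg : 0 < g := by rw [hgdef]; positivity
  have hs₀ : 0 < 2 * Real.sqrt (finrank ℝ V) / g := by positivity
  have hs : 0 < s := lt_of_lt_of_le hs₀ hsle
  have hm1 : (1 : ℝ) ≤ m := by exact_mod_cast hm
  have hnm : 1 ≤ finrank ℝ V * m := Nat.one_le_iff_ne_zero.2 (Nat.mul_ne_zero (by omega) (by omega))
  have hK : 0 < Real.sqrt (finrank ℝ V * m) := Real.sqrt_pos.2 (by exact_mod_cast hnm)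
  have hℓ : 0 < 2 * s * β := by positivity
  -- the auxiliary width `g' = 2√n/s ≤ g` of eq. (16)
  set g' : ℝ := 2 * Real.sqrt (finrank ℝ V) / s with hg'def
  have hg' : 0 < g' := by rw [hg'def]; positivity
  have hg'le : g' ≤ g := by
    rw [hg'def, div_le_iff₀ hs]
    have h := (div_le_iff₀ hg).1 hsle
    linarith
  have hsg' : 2 * Real.sqrt (finrank ℝ V) / g' = s := by
    rw [hg'def]; field_simp
  have hg'L : g' < minNorm L := lt_of_le_of_lt hg'le hgL
  have hodd' : ∀ k : ℤ, Odd k → g' < infDist ((k : ℝ) • t) (L : Set V) := fun k hk =>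
    lt_of_le_of_lt hg'le (hodd k hk)
  -- (15): `η_ε(L*) < √n/(γd) ≤ s/2`
  have hηlt : smoothingParameter (dualLattice L) ε < s / 2 := by
    have h := smoothingParameter_dual_lt_half L hg hgL hnpos
    have h2 : 2 * Real.sqrt (finrank ℝ V) / g / 2 ≤ s / 2 := by linarith
    exact lt_of_lt_of_le h h2
  have hη0 : 0 ≤ smoothingParameter (dualLattice L) ε := smoothingParameter_nonneg (dualLattice L) ε
  have hηs : smoothingParameter (dualLattice L) ε ≤ s := by linarith
  have hηs2 : 2 * smoothingParameter (dualLattice L) ε ≤ s := by linarith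
  -- the abort probability and the conditional witness law
  have hρle := toReal_wRun_none_le b' q d (dualLattice L) rep' hSL hrep hLL' O hε0 hs hηs β
  have hρlt : (p none).toReal < 1 := by rw [hpdef]; linarith
  have hρ : p none ≠ 1 := fun h => by rw [h, ENNReal.toReal_one] at hρlt; exact lt_irrefl _ hρlt
  obtain ⟨D, hD⟩ := exists_cond_law p hρ
  -- Lemma 5.8 (iii) on the grid: `‖x − Cz‖ ≤ 2βη < sβ`
  have hσ : ∀ j, ‖((q * d : ℕ) : ℝ) • b' j‖ ≤
      8 * β * Real.sqrt (finrank ℝ V) * smoothingParameter (dualLattice L) ε := fun j => by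
    rw [hb', smul_gridBasis]; exact hshort j
  have hx : ∀ (cbar : Fin m → (Fin n → ZMod (q * d)) ⧸ gridImage b' (q * d) (dualLattice L))
      (hv : Fin m → (QuotientAddGroup.mk' (gridImage b' (q * d) (dualLattice L))).ker) (z : Fin m → ℤ),
      ‖intVecToEuclidean m z‖ ≤ β →
      ‖combineOutput b' q d (dualLattice L) rep' cbar hv z - ∑ i, (z i : ℝ) • (rep' (cbar i) : V)‖ <
        s * β := by
    intro cbar hv z hz
    have h1 := norm_combine_sub_le_grid b' q d (fun i => rep' (cbar i))
      (fun i => (hv i : Fin n → ZMod (q * d))) z hσ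
    have h2 : (n : ℝ) * Real.sqrt m * ‖intVecToEuclidean m z‖ *
        (8 * β * Real.sqrt (finrank ℝ V) * smoothingParameter (dualLattice L) ε) / q ≤
        2 * β * smoothingParameter (dualLattice L) ε := by
      rw [mul_right_comm ((n : ℝ) * Real.sqrt m)]
      have hq0 : (0 : ℝ) < q := by exact_mod_cast Nat.pos_of_ne_zero (NeZero.ne q)
      refine combine_error_le (n := n) hβ0 hη0 (norm_nonneg _) hq0 ?_ hz ?_
      · rw [hn]
      · exact hmod
    have h3 := two_mul_mul_lt hβ0 hηlt
    exact lt_of_le_of_lt (h1.trans h2) h3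
  have hx' : ∀ (cbar : Fin m → (Fin n → ZMod (q * d)) ⧸ gridImage b' (q * d) (dualLattice L))
      (hv : Fin m → (QuotientAddGroup.mk' (gridImage b' (q * d) (dualLattice L))).ker) (z : Fin m → ℤ),
      ‖intVecToEuclidean m z‖ ≤ β →
      ‖combineOutput b' q d (dualLattice L) rep' cbar hv z - ∑ i, (z i : ℝ) • (rep' (cbar i) : V)‖ ≤
        s * β := fun cbar hv z hz => (hx cbar hv z hz).le
  -- eqs. (16)–(18) for `D`
  have hpg' : wRun b' q d (dualLattice L) rep' hSL hrep O (2 * Real.sqrt (finrank ℝ V) / g') β = p := by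
    rw [hsg']
  have hρ' : (wRun b' q d (dualLattice L) rep' hSL hrep O (2 * Real.sqrt (finrank ℝ V) / g') β) none ≠ 1 := by
    rw [hpg']; exact hρ
  have hD' : ∀ w, (wRun b' q d (dualLattice L) rep' hSL hrep O (2 * Real.sqrt (finrank ℝ V) / g') β)
      (some w) = (1 - (wRun b' q d (dualLattice L) rep' hSL hrep O (2 * Real.sqrt (finrank ℝ V) / g') β)
        none) * D w := fun w => by rw [hpg']; exact hD w
  have h16 := tsum_cond_toReal_mul_cos_le b' q d L rep' hSL hrep O hn2 hg' hg'L t hodd' β hρ' hD'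
  have h17 := tsum_cond_toReal_mul_indicator_le b' q d L rep' hSL hrep O hε0 hε1 hs hηs hnm hx hρ hD
  have h18 : ∀ u : V, ‖u‖ = 1 → ∑' w, D w * ENNReal.ofReal (⟪u, ((w : dualLattice L) : V)⟫_ℝ ^ 2) ≤
      ENNReal.ofReal ((2 * s * β) ^ 2) := fun u hu =>
    tsum_cond_mul_ofReal_inner_sq_le b' q d L rep' hSL hrep O hε0 hε1 hs hηs2 hnum hx' hρ hD hu
  have hnorm := tsum_cond_mul_enorm_sq_le b' q d L rep' hSL hrep O hε0 hε1 hs hηs2 hnum hx' hρ hD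
  -- the blocks
  have hmain := toReal_blocks_not_acceptsZ_le L t hℓ hK p hD h16 h18 h17
    (ENNReal.mul_ne_top (ENNReal.natCast_ne_top _) ENNReal.ofReal_ne_top) hnorm N k hδH hθb hΘ
  rw [witnesses, hpS]
  rw [← hεdef] at hmain
  refine hmain.trans ?_
  gcongr
  rw [ENNReal.toReal_pow]
  exact pow_le_pow_left₀ ENNReal.toReal_nonneg hρle k

/-! ### The idealised reduction with the modified verifier -/

/-- **The idealised reduction of MR07 Thm. 5.23 with the machine-decidable verifier** (thresholds
`θ_b`, `Θ` of tests (b′), (c)): `reductionWith (acceptsZ t θ_b Θ)`.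
[cite: MicciancioRegev2007, Thm. 5.23 (the reduction, pp. 28–29) — verifier tests in the integer form of the tree's ARVerifier] -/
def reductionZ (t : V) (dd β θb Θ : ℝ) (S₀ : Fin n → dualLattice L) (T k₀ N k : ℕ) : PMF Bool :=
  reductionWith L hn q O (acceptsZ L t θb Θ (N := N)) dd β S₀ T k₀ k

omit [MeasurableSpace V] [BorelSpace V] in
/-- **On YES instances the modified idealised reduction answers YES surely**: `Pr[verdict = NO] = 0`
whenever `dist(t, L) ≤ d`, `Θ ≥ 0` and `Θ d² < θ_b N` (no positivity of `d` needed). [cite: MicciancioRegev2007, Thm. 5.23 (proof, YES case, p. 29)] -/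
theorem reductionZ_apply_true_eq_zero {t : V} {dd θb Θ : ℝ} (hdist : infDist t (L : Set V) ≤ dd)
    (hΘ0 : 0 ≤ Θ) {N : ℕ} (hΘ : Θ * dd ^ 2 < θb * N) (β : ℝ) (S₀ : Fin n → dualLattice L) (T k₀ k : ℕ) :
    (reductionZ L hn q O t dd β θb Θ S₀ T k₀ N k) true = 0 :=
  reductionWith_apply_true_eq_zero L hn q O (not_acceptsZ_of_infDist_le L hdist hΘ0 hΘ) dd β S₀ T k₀ k

/-- **MR07 Thm. 5.23, NO case, for the idealised reduction with the modified verifier**: on a NO instance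
of `GapCVP′_γ` (`λ₁(L) > γd` and `dist(kt, L) > γd` for all odd `k`, `γ = 14π√nβ`), with `ε = 2⁻ⁿ`, the
modulus conditions `4√m n^{1.5} β ≤ q`, `8n√m β ≤ q`, the side condition of Thm. 5.9, an oracle whose `SIS′`
success `δ′` on uniform queries exceeds `2mε/(1+ε)`, a loop length `T` exceeding the potential bound of
Lemma 5.10 from `S₀`, and thresholds `θ_b ≤ (1 − 2ε)/(2π²) − δ_H`, `Θ ≥ 12N/(49π²d²)`:
`Pr[verdict = YES] ≤ (T+1)(1−p)^{k₀} + N(1 − (δ′ − 2mε/(1+ε)))^k + e^{−32Nδ_H²} + e^{−N/(nm)²}(4√n·nm)ⁿ +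
N·m(1+ε)/(1−ε)ε`, `p = (δ_{SIS}/(2βm) − 2mε/(1+ε))/3`.
[cite: MicciancioRegev2007, Thm. 5.23 (proof, NO case, pp. 29–31) with Cor. 5.13 — distance-to-ℤ test] -/
theorem toReal_reductionZ_false_le (hn2 : 2 ≤ finrank ℝ V) (t : V) {β dd lam δH θb Θ : ℝ} (hβ : 1 ≤ β)
    (hdd : 0 < dd) (hm : 0 < m)
    (hgL : 14 * π * Real.sqrt (finrank ℝ V) * β * dd < minNorm L)
    (hodd : ∀ k : ℤ, Odd k → 14 * π * Real.sqrt (finrank ℝ V) * β * dd < infDist ((k : ℝ) • t) (L : Set V))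
    (hmod : 4 * Real.sqrt m * ((n : ℝ) * Real.sqrt n) * β ≤ q) (hq : 8 * n * Real.sqrt m * β ≤ q)
    (hnum : 1 / (2 * π) + (2⁻¹ : ℝ) ^ finrank ℝ V / (1 - (2⁻¹ : ℝ) ^ finrank ℝ V) +
      ((2⁻¹ : ℝ) ^ finrank ℝ V / (1 - (2⁻¹ : ℝ) ^ finrank ℝ V)) ^ 2 * m ≤ 1 / 6)
    (hδ : m * (2 * (2⁻¹ : ℝ) ^ finrank ℝ V / (1 + (2⁻¹ : ℝ) ^ finrank ℝ V)) <
      (((PMF.uniformOfFintype (Matrix (Fin n) (Fin m) (ZMod q))).bind fun A =>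
          (O A).map (Prod.mk A)).toOuterMeasure {az | IsSolution' az.1 β az.2}).toReal)
    (hlam0 : 0 ≤ lam) (hlam : ∀ v ∈ dualLattice L, v ≠ 0 → lam ≤ ‖v‖)
    (S₀ : Fin n → dualLattice L) (hS₀ : LinearIndependent ℝ fun j => (S₀ j : V)) (T k₀ N k : ℕ)
    [NeZero N] (hT : (3 / 4 : ℝ) ^ (T + 1) * ∏ j, ‖(S₀ j : V)‖ < lam ^ n)
    {p₁ : ℝ} (hp₁ : p₁ = (1 / 3 : ℝ) *
        ((((PMF.uniformOfFintype (Matrix (Fin n) (Fin m) (ZMod q))).bind fun A =>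
            (O A).map (Prod.mk A)).toOuterMeasure {az | IsSolution az.1 β az.2}).toReal / (2 * β * m) -
          m * (2 * (2⁻¹ : ℝ) ^ finrank ℝ V / (1 + (2⁻¹ : ℝ) ^ finrank ℝ V))))
    (hδH : 0 ≤ δH) (hθb : θb ≤ (1 - 2 * (2⁻¹ : ℝ) ^ finrank ℝ V) / (2 * π ^ 2) - δH)
    (hΘ : N * (12 / (49 * π ^ 2 * dd ^ 2)) ≤ Θ) :
    ((reductionZ L hn q O t dd β θb Θ S₀ T k₀ N k) false).toReal ≤
      (T + 1 : ℝ) * (1 - p₁) ^ k₀ +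
        (N * (1 - ((((PMF.uniformOfFintype (Matrix (Fin n) (Fin m) (ZMod q))).bind fun A =>
            (O A).map (Prod.mk A)).toOuterMeasure {az | IsSolution' az.1 β az.2}).toReal -
              m * (2 * (2⁻¹ : ℝ) ^ finrank ℝ V / (1 + (2⁻¹ : ℝ) ^ finrank ℝ V)))) ^ k +
          (Real.exp (-(32 * N * δH ^ 2)) +
            (Real.exp (-(N / Real.sqrt (finrank ℝ V * m) ^ 4)) *
                (4 * Real.sqrt (finrank ℝ V) * Real.sqrt (finrank ℝ V * m) ^ 2) ^ finrank ℝ V +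
              N * (m * ((1 + (2⁻¹ : ℝ) ^ finrank ℝ V) / (1 - (2⁻¹ : ℝ) ^ finrank ℝ V) *
                (2⁻¹ : ℝ) ^ finrank ℝ V))))) := by
  set ε : ℝ := (2⁻¹ : ℝ) ^ finrank ℝ V with hεdef
  have hn1 : 1 ≤ finrank ℝ V := by omega
  have hε0 : 0 < ε := by rw [hεdef]; positivity
  have hε1 : ε < 1 := by
    rw [hεdef]
    calc (2⁻¹ : ℝ) ^ finrank ℝ V ≤ (2⁻¹ : ℝ) ^ 1 := pow_le_pow_of_le_one (by norm_num) (by norm_num) hn1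
      _ < 1 := by norm_num
  -- the error `E ≥ 0`
  have hρle1 : (((PMF.uniformOfFintype (Matrix (Fin n) (Fin m) (ZMod q))).bind fun A =>
      (O A).map (Prod.mk A)).toOuterMeasure {az | IsSolution' az.1 β az.2}).toReal ≤ 1 := by
    have h : (((PMF.uniformOfFintype (Matrix (Fin n) (Fin m) (ZMod q))).bind fun A =>
        (O A).map (Prod.mk A)).toOuterMeasure {az | IsSolution' az.1 β az.2}) ≤ 1 := by
      rw [PMF.toOuterMeasure_apply]
      exact (ENNReal.tsum_le_tsum fun a => Set.indicator_le_self _ _ a).trans_eq (PMF.tsum_coe _)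
    exact ENNReal.toReal_le_of_le_ofReal zero_le_one (by rwa [ENNReal.ofReal_one])
  have hmε : 0 ≤ (m : ℝ) * (2 * ε / (1 + ε)) := by positivity
  have hE0 : 0 ≤ N * (1 - ((((PMF.uniformOfFintype (Matrix (Fin n) (Fin m) (ZMod q))).bind fun A =>
      (O A).map (Prod.mk A)).toOuterMeasure {az | IsSolution' az.1 β az.2}).toReal -
        m * (2 * ε / (1 + ε)))) ^ k +
      (Real.exp (-(32 * N * δH ^ 2)) +
        (Real.exp (-(N / Real.sqrt (finrank ℝ V * m) ^ 4)) *
            (4 * Real.sqrt (finrank ℝ V) * Real.sqrt (finrank ℝ V * m) ^ 2) ^ finrank ℝ V +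
          N * (m * ((1 + ε) / (1 - ε) * ε)))) := by
    have h1 : 0 ≤ 1 - ((((PMF.uniformOfFintype (Matrix (Fin n) (Fin m) (ZMod q))).bind fun A =>
        (O A).map (Prod.mk A)).toOuterMeasure {az | IsSolution' az.1 β az.2}).toReal -
          m * (2 * ε / (1 + ε))) := by linarith
    have h2 : 0 ≤ (1 + ε) / (1 - ε) * ε := by
      have : 0 < 1 - ε := by linarith
      positivity
    positivity
  -- the printed parameter `s = 2√n/(γd)` and the threshold `3(2sβ)² = 12/(49π²d²)`
  have hβ0 : 0 < β := by linarith
  have hΘ' : N * (3 * (2 * (2 * Real.sqrt (finrank ℝ V) / (14 * π * Real.sqrt (finrank ℝ V) * β * dd)) *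
      β) ^ 2) ≤ Θ := by
    rw [three_mul_sq_printed hn1 hβ0 hdd]; exact hΘ
  rw [reductionZ]
  refine toReal_reductionWith_false_le L hn q O hn2 _ hβ hm hq hnum hlam0 hlam S₀ hS₀ T k₀ k hT hp₁ hE0 ?_
  intro S hS d _ hd hshort
  exact toReal_witnesses_not_acceptsZ_le L hn q O S hS d hd hn2 t _ hβ hdd hm hgL hodd le_rfl hshort hmod
    (by rw [← hεdef]; linarith) hδ N k hδH hθb hΘ'

end ReductionWith

end MicciancioRegev2007

end Literature.Algebra.EuclideanLattices

end
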